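import Mathlib.LinearAlgebra.Matrix.Block
import Literature.Computability.AlgebraicComplexity.CwSquareGenericTransfer
import Literature.Computability.AlgebraicComplexity.CwSquareGenericCount
import Literature.Computability.AlgebraicComplexity.BorderRankCWKoszulRanksSqTwoProofs
import Literature.Computability.AlgebraicComplexity.BorderRankCWKoszulRanksSqThree
import Literature.Computability.AlgebraicComplexity.BorderRankCWKoszulQ4
import HarnessLib

/-!
# `bR(T_{cw,q}^{⊠2}) = (q+2)²` for `q > 2` and the discharge of `CGLV2022_thm12_square`

Topic: `Literature/Computability/AlgebraicComplexity`. Final step F4 of the proof of the square part of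
Conner–Gesmundo–Landsberg–Ventura, *Rank and border rank of Kronecker powers of tensors and Strassen's
laser method*, comput. complexity 31 (2022) = arXiv:1909.04785v2, **Thm. 1.2** (journal: Thm. 2.1):
"For all `q > 2`, `bR(T_{cw,q}^{⊠2}) = (q+2)²`, and `15 ≤ bR(T_{cw,2}^{⊠2}) ≤ 16`", vendored as the named
fact `CGLV2022_thm12_square` (`BorderRankCW.lean`) and PROVED here (`CGLV2022_thm12_square_holds`).

## The lower bound for `q ≥ 5` (this file)

By `CwSquareGenericTables.lean` / `CwSquareGenericTransfer.lean`, the local peeling conditions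
`CwSqGen.GoodAt q` hold for every `q ≥ 5` for the `p = 1` Koszul flattening
`K = K_φ(T_{cw,q}^{⊠2})` of `CwSquareGenericPhi.lean`. Order the pivot rows (`CwSqGen.PivRow q`,
`2(q+2)²` of them by `CwSquareGenericCount.lean`) by the potential "row-rounds ascending, then
column-rounds descending, ties by position" (`CwSqGen.pot`); the peeling conditions say exactly that
the `PivRow × PivRow` minor of `K` (pivot row against partner column) is LOWER TRIANGULAR with
non-zero diagonal in this order (`kgen_eq_zero_of_pot_lt`, `kgen_pcol_ne_zero`), so it has non-zero
determinant, `rank K ≥ 2(q+2)² > 2((q+2)² - 1)`, and `bR(T_{cw,q}^{⊠2}) ≥ (q+2)²` by the Koszul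
bound (minor criterion `le_algBorderRank_sq_cwTensor_of_det_ne_zero'`): `sq_le_algBorderRank_sq_cwTensor`.

## Assembly

* upper bounds `bR(T_{cw,q}^{⊠2}) ≤ (q+2)²`, `bR(T_{cw,2}^{⊠2}) ≤ 16`: `CGLV2022_thm12_upper`
  (`BorderRankCWKoszulRanks.lean`: `bR(T_{cw,q}) ≤ q+2` and submultiplicativity);
* `q = 2`: `le_algBorderRank_cwTensor_two_sq` (`BorderRankCWKoszulRanksSqTwoProofs.lean`);
* `q = 3`: `CGLV2022_koszulRank_sq_three_holds` (`BorderRankCWKoszulRanksSqThree.lean`, the `p = 2`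
  flattening, "left to the reader" in the source) with `le_algBorderRank_cwTensor_three_sq_of`;
* `q = 4`: `CGLV2022_thm33_koszulRank_q4_holds` (`BorderRankCWKoszulQ4.lean`, the source's `φ₂`,
  rank `72`);
* `q ≥ 5`: this file.

## References

* A. Conner, F. Gesmundo, J. M. Landsberg, E. Ventura, comput. complexity 31 (2022) =
  arXiv:1909.04785v2, Thm. 1.2 (journal Thm. 2.1), §3.3/§4.3, §4.5.
  [ConnerGesmundoLandsbergVentura2022]
-/

open scoped BigOperators
open Matrix

namespace Literature.Computability.AlgebraicComplexity

namespace CwSqGen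

variable {q : ℕ}

/-! ## Pivot data and the potential -/

/-- The pivot datum (round, kind, partner column) of a pivot row. [folklore] -/
def pinfo (ω : PivRow q) : ℕ × Bool × Col q := (rowInfo ω.1).get ω.2

/-- The partner (pivot) column of a pivot row. [folklore] -/
def pcolOf (ω : PivRow q) : Col q := (pinfo ω).2.2

/-- `rowInfo` of a pivot row is its datum. [folklore] -/
theorem rowInfo_eq_pinfo (ω : PivRow q) :
    rowInfo ω.1 = some ((pinfo ω).1, (pinfo ω).2.1, pcolOf ω) :=
  (Option.some_get ω.2).symm

/-- The level of a pivot: its round for row-rounds, `50 - round` for column-rounds (so that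
column-round pivots come after all row-round pivots, in decreasing order of rounds). [folklore] -/
def lev (ω : PivRow q) : ℕ := if (pinfo ω).2.1 = true then (pinfo ω).1 else 50 - (pinfo ω).1

/-- Position code of a row (injective). [folklore] -/
def code (r : Row q) : ℕ := (r.2.2.val + (q + 1) * r.2.1.val) + (q + 1) * (q + 1) * r.1.val

/-- The code is below `3(q+1)²`. [folklore] -/
theorem code_lt (r : Row q) : code r < 3 * ((q + 1) * (q + 1)) := by
  unfold code
  have h1 := r.2.2.isLt
  have h2 := r.2.1.isLt
  have h3 := r.1.isLt
  nlinarith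

/-- The code is injective. [folklore] -/
theorem code_injective : Function.Injective (code (q := q)) := by
  intro r r' h
  unfold code at h
  have hq : 0 < q + 1 := Nat.succ_pos q
  have e₁ : (r.2.2.val + (q + 1) * r.2.1.val) / ((q + 1) * (q + 1)) = 0 :=
    Nat.div_eq_of_lt (by nlinarith [r.2.2.isLt, r.2.1.isLt])
  have e₁' : (r'.2.2.val + (q + 1) * r'.2.1.val) / ((q + 1) * (q + 1)) = 0 :=
    Nat.div_eq_of_lt (by nlinarith [r'.2.2.isLt, r'.2.1.isLt])
  have ht : r.1.val = r'.1.val := by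
    have := congrArg (· / ((q + 1) * (q + 1))) h
    simp only [Nat.add_mul_div_left _ _ (by positivity : 0 < (q + 1) * (q + 1)), e₁, e₁',
      zero_add] at this
    exact this
  have hrest : r.2.2.val + (q + 1) * r.2.1.val = r'.2.2.val + (q + 1) * r'.2.1.val := by
    rw [ht] at h
    omega
  have hc₁ : r.2.1.val = r'.2.1.val := by
    have := congrArg (· / (q + 1)) hrest
    simp only [Nat.add_mul_div_left _ _ hq, Nat.div_eq_of_lt r.2.2.isLt,
      Nat.div_eq_of_lt r'.2.2.isLt, zero_add] at this
    exact this
  have hc₂ : r.2.2.val = r'.2.2.val := by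
    rw [hc₁] at hrest
    omega
  exact Prod.ext (Fin.ext ht) (Prod.ext (Fin.ext hc₁) (Fin.ext hc₂))

/-- **The potential**: level first, position second. [folklore] -/
def pot (ω : PivRow q) : ℕ := code ω.1 + 3 * ((q + 1) * (q + 1)) * lev ω

/-- `pot / (3(q+1)²) = lev`. [folklore] -/
theorem pot_div (ω : PivRow q) : pot ω / (3 * ((q + 1) * (q + 1))) = lev ω := by
  unfold pot
  rw [Nat.add_mul_div_left _ _ (by positivity), Nat.div_eq_of_lt (code_lt ω.1), zero_add]

/-- The potential is injective. [folklore] -/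
theorem pot_injective : Function.Injective (pot (q := q)) := by
  intro ω ω' h
  have hl : lev ω = lev ω' := by rw [← pot_div ω, ← pot_div ω', h]
  have hc : code ω.1 = code ω'.1 := by
    unfold pot at h
    rw [hl] at h
    omega
  exact Subtype.ext (code_injective hc)

/-- A smaller potential has a level that is not larger. [folklore] -/
theorem lev_le_of_pot_lt {ω ω' : PivRow q} (h : pot ω < pot ω') : lev ω ≤ lev ω' := by
  rw [← pot_div ω, ← pot_div ω']
  exact Nat.div_le_div_right h.le

/-! ## Triangularity from the peeling conditions -/

/-- The pivot entry of a pivot row is non-zero. [folklore] -/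
theorem kgen_pcol_ne_zero (hg : GoodAt q) (ω : PivRow q) : kgen q ω.1 (pcolOf ω) ≠ 0 :=
  (rowOkB_spec (hg.1 ω.1) (rowInfo_eq_pinfo ω)).2.1

/-- **Lower triangularity**: a pivot row has zero entry in the partner column of every pivot of
larger potential. [folklore] -/
theorem kgen_eq_zero_of_pot_lt (hg : GoodAt q) {ω ω' : PivRow q} (h : pot ω < pot ω') :
    kgen q ω.1 (pcolOf ω') = 0 := by
  by_contra hne
  obtain ⟨hrow, hcol⟩ := hg
  have hω := rowInfo_eq_pinfo ω
  have hω' := rowInfo_eq_pinfo ω'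
  obtain ⟨h1, -, h3, h4⟩ := rowOkB_spec (hrow ω.1) hω
  obtain ⟨h1', -, h3', -⟩ := rowOkB_spec (hrow ω'.1) hω'
  have hlev := lev_le_of_pot_lt h
  have hne_ω : ω.1 ≠ ω'.1 := fun e => (ne_of_lt h) (by rw [Subtype.ext e])
  -- (T1) for `ω` (if its round is a row-round): round ω' < round ω
  have A : (pinfo ω).2.1 = true → (pinfo ω').1 < (pinfo ω).1 := fun hk => by
    rcases h4 hk (pcolOf ω') hne with e | e
    · exfalso
      apply hne_ω
      rw [e, h1] at h1'
      simp only [Option.some.injEq, Prod.mk.injEq] at h1'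
      exact h1'.2.2
    · unfold colRoundLt at e
      rw [h1'] at e
      simpa using e
  -- (T2) for the column of `ω'` (if its round is a column-round): round ω < round ω'
  have B : (pinfo ω').2.1 = false → (pinfo ω).1 < (pinfo ω').1 := fun hk' => by
    obtain ⟨-, -, h5⟩ := colOkB_spec (hcol (pcolOf ω')) h1'
    rcases h5 hk' ω.1 hne with e | e
    · exact absurd e hne_ω
    · unfold rowRoundLt at e
      rw [hω] at e
      simpa using e
  unfold lev at hlev
  rcases Bool.eq_false_or_eq_true (pinfo ω).2.1 with hk | hk <;>
    rcases Bool.eq_false_or_eq_true (pinfo ω').2.1 with hk' | hk'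
  · have hA := A hk
    rw [if_pos hk, if_pos hk'] at hlev
    omega
  · have hA := A hk
    have hB := B hk'
    omega
  · rw [if_neg (by rw [hk]; decide), if_pos hk'] at hlev
    omega
  · have hB := B hk'
    rw [if_neg (by rw [hk]; decide), if_neg (by rw [hk']; decide)] at hlev
    omega

/-! ## The non-zero minor and the lower bound for `q ≥ 5` -/

/-- **The pivot minor is non-zero** (`q ≥ 5`): lower triangular with non-zero diagonal in the
peeling order. [cite: ConnerGesmundoLandsbergVentura2022, Thm. 1.2] -/
theorem det_pivMinor_ne_zero (hq : 5 ≤ q) :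
    ((koszulFlattening 1 (genM q).mulVecLin (cwSq ℤ q)).submatrix
      (fun ω : PivRow q => rowIdx ω.1) (fun ω : PivRow q => colIdx (pcolOf ω))).det ≠ 0 := by
  have hg : GoodAt q := goodAt_of_five_le hq
  letI : LinearOrder (PivRow q) := LinearOrder.lift' pot pot_injective
  rw [Matrix.det_of_lowerTriangular _ (fun ω ω' hlt => by
    rw [Matrix.submatrix_apply, ← kgen_eq]
    exact kgen_eq_zero_of_pot_lt hg (OrderDual.toDual_lt_toDual.1 hlt))]
  rw [Finset.prod_ne_zero_iff]
  intro ω _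
  rw [Matrix.submatrix_apply, ← kgen_eq]
  exact kgen_pcol_ne_zero hg ω

/-- **The lower bound for `q ≥ 5`**: `(q+2)² ≤ bR(T_{cw,q}^{⊠2})` — the `p = 1` Koszul flattening of
`φ(T_{cw,q}^{⊠2})` has a non-zero minor of size `2(q+2)² > 2((q+2)² - 1)`.
[cite: ConnerGesmundoLandsbergVentura2022, Thm. 1.2] -/
theorem sq_le_algBorderRank_sq_cwTensor (hq : 5 ≤ q) :
    (q + 2) ^ 2 ≤ algBorderRank (kroneckerPow (cwTensor ℂ q) 2) := by
  refine le_algBorderRank_sq_cwTensor_of_det_ne_zero' 1 (genM q) _ _ (det_pivMinor_ne_zero hq) ?_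
  rw [card_pivRow hq, show Nat.choose (2 * 1) 1 = 2 by decide]
  have : 1 ≤ (q + 2) ^ 2 := Nat.one_le_pow _ _ (by omega)
  omega

end CwSqGen

/-! ## CGLV 2022, Thm. 1.2, the square case -/

/-- `q = 4`: `36 ≤ bR(T_{cw,4}^{⊠2})` from the kernel-certified rank `72` of the source's `p = 1`
flattening (`BorderRankCWKoszulQ4.lean`). [cite: ConnerGesmundoLandsbergVentura2022, Thm. 1.2] -/
theorem le_algBorderRank_cwTensor_four_sq : 36 ≤ algBorderRank (kroneckerPow (cwTensor ℂ 4) 2) := by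
  have h : (koszulFlattening 1 (cglvPhi2 ℂ 4).mulVecLin (kroneckerPow (cwTensor ℂ 4) 2)).rank = 72 :=
    CGLV2022_thm33_koszulRank_q4_holds
  refine le_algBorderRank_of_lt_rank_koszulFlattening 1 (cglvPhi2 ℂ 4) _ ?_
  rw [h, show Nat.choose (2 * 1) 1 = 2 by decide]
  norm_num

/-- **CGLV 2022, Thm. 1.2 (square case) — the lower bounds**: `(q+2)² ≤ bR(T_{cw,q}^{⊠2})` for all
`q ≥ 3`. [cite: ConnerGesmundoLandsbergVentura2022, Thm. 1.2] -/
theorem sq_le_algBorderRank_sq_cwTensor_of_three_le {q : ℕ} (hq : 3 ≤ q) :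
    (q + 2) ^ 2 ≤ algBorderRank (kroneckerPow (cwTensor ℂ q) 2) := by
  rcases (show q = 3 ∨ q = 4 ∨ 5 ≤ q by omega) with rfl | rfl | h5
  · exact le_algBorderRank_cwTensor_three_sq_of CGLV2022_koszulRank_sq_three_holds
  · exact le_algBorderRank_cwTensor_four_sq
  · exact CwSqGen.sq_le_algBorderRank_sq_cwTensor h5

/-- **Conner–Gesmundo–Landsberg–Ventura 2022, Thm. 1.2, Kronecker squares** (discharge of the named
fact `CGLV2022_thm12_square`): for all `q > 2`, `bR(T_{cw,q}^{⊠2}) = (q+2)²`, and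
`15 ≤ bR(T_{cw,2}^{⊠2}) ≤ 16`. [cite: ConnerGesmundoLandsbergVentura2022, Thm. 1.2] -/
theorem CGLV2022_thm12_square_holds : CGLV2022_thm12_square :=
  ⟨fun q hq => le_antisymm (CGLV2022_thm12_upper.1 q) (sq_le_algBorderRank_sq_cwTensor_of_three_le hq),
    le_algBorderRank_cwTensor_two_sq, CGLV2022_thm12_upper.2.2⟩

end Literature.Computability.AlgebraicComplexity
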